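import Literature.MathematicalPhysics.QuantumFieldTheory.Balaban1983to89.B9Ineq349Hom
import Literature.MathematicalPhysics.QuantumFieldTheory.Balaban1983to89.B6RandomWalkSection
import Literature.MathematicalPhysics.QuantumFieldTheory.Balaban1983to89.B9Eq371GradLetters
import Literature.MathematicalPhysics.QuantumFieldTheory.Balaban1983to89.B9Eq352DivFormLetters

/-!
# `Balaban1983to89.B9Ineq3133KernelConcrete` — [Balaban1985BackgroundPropagators] (3.133) p. 422, THE TWO SUP MEMBERS `|H_{μν}(x,y′)|,
# |∇H_{μν}(x,y′)| ≦ O(1)[1, (Lʲη)⁻¹](L^{j′}η)^{−d}e^{−(1/2)δ₁d(y,y′)}` FOR THE WORD `H = G·Q*·(QGQ*)⁻¹` OF (3.126) ITSELF — the letters `G` (Theorem 3.3,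
# (3.42)₁,₂ as block majorants), `Q*` ((3.15), block-local, coarse lattice → bonds) and `(QGQ*)⁻¹` (the (3.132) kernel bound in the coarse pairing) typed
# between their carriers as in the Sect. B lineage, AT THE PRINTED RATE `(1/2)δ₁` — FILE 64 of cell `lit-balaban`, seat r06 (B9 fold owner) gen 23: the
# typed-letter companion of gen 3's `B9Ineq3133Assembly` (the same hence-step over ABSTRACT seminorms `p_y` and vectors `g_{y″}`); v1.1 (append-only): + the
# `(L^{j′}η)⁻¹` variant of the sentence after (3.133) for the literal `H` of (3.109)–(3.110) (§3) + §2 on the lineage's bond carrier with its `∇_k` letters (§4);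
# v1.2 (gen 79, append-only, lit-balaban desk IR-NE7-G118-1): + §5 the SUMMED form — the `ℓ^∞ → ℓ^∞` operator bound for `H` and `X_k·H` (`ineq3133_sup_operator`);
# v1.3 (gen 79, DOC-ONLY): five own page numerals corrected — (3.15) is p. 393 [PDF 5] (not 392), (3.109)–(3.110) are p. 417 [PDF 29] (not 418); no declaration touched

statement-level skeleton of published theorems with citation tags; proofs where landed; nothing here is a claim about the Yang–Mills mass gap

CITATION HEADER (lean-in-tree rule).  B9 = T. Bałaban, *Propagators for lattice gauge theories in a background field*, Commun. Math. Phys. **99** (1985)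
389–434 [Balaban1985BackgroundPropagators] (held `paper:balaban1985-cmp99-background-propagators`, journal page = PDF page + 388).  (3.126) p. 420
«HB = GQ*(QGQ*)⁻¹B. (3.126)»; p. 422 [PDF 34] «We have |(QGQ*)⁻¹(y, y′)| ≦ O(1)(Lʲη)⁻²(L^{j′}η)^{−d}e^{−δ₁d(y,y′)} for y ∈ Λ_j, y′ ∈ Λ_{j′}, (3.132) and the same
for the operator with G₁ instead of G. The above inequality together with Theorem 3.3 for G, with the exception of the inequality involving the
covariant Laplace operator in (3.42), give |H_{μν}(x, y′)|, |∇H_{μν}(x, y′)|, ‖ζ∇H(·, y′)‖_β ≦ O(1)[1, (Lʲη)⁻¹, (‖ζ‖^ξ_β + |ζ|)(Lʲη)^{−1−β}](L^{j′}η)^{−d}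
e^{−(1/2)δ₁d(y,y′)}, for x ∈ Δ(y), or ζ ∈ C^∞₀(Δ̃(y)), y ∈ Λ_j, y′ ∈ Λ_{j′}. (3.133)»; Theorem 3.3 p. 399 «the operator G(U) (a = 1) satisfies the
inequalities (3.42)–(3.47), with G′(U) replaced by G(U) and λ replaced by a function J defined at bonds»; (3.42) p. 397 (the entries `G`, `∇_UG`,
rate `δ₀`); (3.15) p. 393 (the block-local averaging `Q_j(U)`); p. 398 [PDF 10] L20–24 «Next, the choice of powers Lʲη is conventional also. Using Lemma
2.1 in [4] we may replace the factor (Lʲη)^α by (Lʲη)^β(L^{j′}η)^γ with β + γ = α, j, j′ are indices of localizations».  [4] = [Balaban1984PropagatorsII]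
T. Bałaban, *Propagators and renormalization transformations for lattice gauge theories. II*, Commun. Math. Phys. **96** (1984) 223–250: (2.51)–(2.55)
p. 232, Lemma 2.1 (2.60)–(2.61) p. 234.  Row B9.Eq3.133 (cells; the head is the lead's word).

WHAT IS PROVED (theorems only: 0 `def`, 0 sorry, 0 named facts; standard axioms).
* §1 **`ineq3133_sup_word`** — GENERIC rates, EXPLICIT constant: bond carrier `W` (block map `blk`), coarse lattice `𝔅 = g.Site` (identity block
  map); from Theorem 3.3's (3.42)₁ for `G` and (3.42)₂ for the left words `X_k·G` as block majorants (`B₀(Lʲη)²e^{−δ₀d}`, `B₀(Lʲη)e^{−δ₀d}`), the block-local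
  two-space letter `Q*` (coarse → bonds, size `κ_Q`), and ANY coarse operator `C_q` with the (3.132) kernel bound in the coarse pairing of the lineage
  (`B9Thm34Inv.ker (vol g d)`: `|C_q(y,y′)| ≦ C_K(Lʲη)⁻²(L^{j′}η)^{−d}e^{−δ₁d}`), with [4] Lemma 2.1 at exponent `β`, the p. 398 transfer of `(Lʲη)⁻²` at
  exponent `α` (constant `Λ`) and a rate `ρ ≦ δ₁` with `ρ + (α+β)δ₀ ≦ δ₀`: the two-space word `H = G ∘ Q* ∘ C_q : (𝔅 → ℝ) → (W → ℝ)` and the words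
  `X_k·G ∘ Q* ∘ C_q` have the block majorants `K·e^{−ρd(y,y′)}` and `K·(Lʲη)⁻¹·e^{−ρd(y,y′)}`, `K = B₀κ_QC_KΛc₁(β)` — one block-local composition and ONE
  decaying composition ([4] (2.52)–(2.55) + the y″-sum, gen 11's `hasMajorantHom_local_comp`/`hasMajorantHom_comp_decay`), print's «together … give».
* §2 **`ineq3133_sup_printed`** — THE PRINTED RATE: under `0 < δ₁ ≦ δ₀` (exponents `α = β = 1/4`: `δ₁/2 + δ₀/2 ≦ δ₀`), with [4] Lemma 2.1 «for every
  0 < α < 1» and the p. 398 transfers for every exponent (the lineage's 6-tuple `hST`): `∃ K ≧ 0` with the two majorants at rate `δ₁/2` AND, letter for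
  letter, the ENTRY bounds `|(G Q* C_q 1_{y′})(q)| ≦ K·e^{−(δ₁/2)d(y(q),y′)}`, `|(X_kG Q* C_q 1_{y′})(q)| ≦ K·(Lʲη)⁻¹·e^{−(δ₁/2)d(y(q),y′)}` for every bond point
  `q` and coarse site `y′` — which, divided by the coarse volume weight `vol(y′) = (L^{j′}η)^d` of the pairing (the convention of `B9Thm34Inv.ker`, under
  which (3.132) and (3.48) are typed), are the printed kernels `|H(x,y′)|, |∇H(x,y′)| ≦ K[1, (Lʲη)⁻¹](L^{j′}η)^{−d}e^{−(1/2)δ₁d(y,y′)}`.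

* §3 (v1.1, append-only) **`ineq3133_sup_literal`** — THE SENTENCE AFTER (3.133), its `(L^{j′}η)⁻¹` variant: for any coarse `D` acting as the diagonal
  factor `(Df)(y′) = (L^{j′}η)⁻¹f(y′)` (print: «include the additional factor (L^{j′}η)⁻¹ in this formula»), the literal `H_lit = G ∘ Q* ∘ C_q ∘ D` of
  (3.109)–(3.110) and the words `X_k·G ∘ Q* ∘ C_q ∘ D` obey the entry bounds of §2 times `(L^{j′}η)⁻¹` («we get (3.133) with an additional factor … (L^{j′}η)⁻¹»).
* §4 (v1.1) **`ineq3133_sup_printed_lineage`** — §2 ON THE LINEAGE'S BOND CARRIER `(κ × S) × ι` (block map `q ↦ blk q.1.2`) WITH ITS COVARIANT DIFFERENCE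
  LETTERS `X_k = conj b (diffLetter (bT T) (bU U) η⁻¹ k)`, `k : κ ⊕ κ` (`B9Eq371GradLetters`): the hypotheses `hG`/`hDG` are the Theorem-3.3 hypotheses `hG`/`hDG`
  of `B9Ineq346L2RightDiffG.thm34_G_l2_right_final` VERBATIM (an instantiation of §2, no further hypothesis).
* §5 (v1.2, append-only) **`abs_apply_le_rowSum_of_hasMajorantHom`** (two-space block majorant ⟹ `|(Tμ)(v)| ≦ (Σ_{y′}K(y(v),y′))·‖μ‖_∞`) and
  **`ineq3133_sup_operator`** — §2 SUMMED OVER `y′` with [4] Lemma 2.1 (2.61) at `α = δ₁/(2δ₀)`: `∃ K′ ≧ 0` with `|(G Q* C_q μ)(q)| ≦ K′‖μ‖_∞` and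
  `|(X_kG Q* C_q μ)(q)| ≦ K′(Lʲη)⁻¹‖μ‖_∞` for every coarse `μ` (print displays no such summed inequality; it is the hence-step p. 422 uses for `H*J`).
HONEST SCOPE / NOT CLAIMED.  (i) Theorem 3.3 for `G` and (3.132) for `(QGQ*)⁻¹` are the INPUTS (rows B9.Thm3.3, B9.Eq3.132 — print's «The above
inequality together with Theorem 3.3 … give»): the file certifies the hence-step for the word `H` itself with typed letters; it proves neither input.
(ii) Only the two SUP members of (3.133); the Hölder member `‖ζ∇H(·,y′)‖_β` is gen 3's `B9Ineq3133Assembly.ineq3133_printed_holder` (the (3.43) member of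
Theorem 3.3 for `G` entering as the abstract localized seminorm — the Hölder zone G-B9-02 of the block).  (iii) `Q*` is an abstract block-local two-space
letter of size `κ_Q` (print: the adjoint of `Q_j(U)` of (3.15), `|Q| ≦ 1`; the lineage's (S2) seam: print's `Q_j(U)` lives on other carriers in the tree);
`C_q` is any coarse operator with the (3.132) bound (print: THE inverse `(QGQ*)⁻¹` — its inverse property is not used by the bound); `G`, `X_k·G` are
abstract letters with Theorem 3.3's (3.42)₁,₂ majorants (print: `G = G(U)` of (3.27), `X_k = ∇_U` in a direction; §4 instantiates `X_k` at the lineage's letters).  (iv) `K` depends on `B₀, κ_Q, C_K, d, δ₀`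
and `Λ(1/4)` only («O(1)»); the rate `(1/2)δ₁` is reached exactly because print halves `δ₁` ((3.132) at `δ₁`, Theorem 3.3 at `δ₀ ≧ δ₁`).  (v) Of the sentence after (3.133) only the
«(L^{j′}η)⁻¹» alternative is certified (§3); the «(Lʲη)⁻¹» alternative is print's p. 398 transfer and is not asserted.  NOT summit progress.

RELATED IN THE TREE, NOT DUPLICATED (searched 2026-08-23: `lean search --decl 'ineq3133'` = gen 3's `B9Ineq3133Assembly.ineq3133_assembled/_printed/
_printed_sup/_printed_holder` (abstract seminorms `p_y`, abstract vectors `g_{y″} = G(Q*1_{y″})`, kernel `K` as a real function; `B6.Geometry` with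
`RowSum`/`Ineq260`) and the hypothesis shape `B9.Ineq3133`/`B9.ineq3133_restrict`; `lean search --decl 'KernelConcrete'` = ∅): here the word `G ∘ Q* ∘ C_q`
with the lineage's typed letters (`HasMajorant`/`HasMajorantHom`/`B9Thm34Inv.ker`), so that Theorem-3.3-shaped hypotheses of the Sect. B files
(`B9Ineq346L2RightDiffG`'s `hG`/`hDG`) feed it by name.
-/

noncomputable section

namespace Literature.MathematicalPhysics.QuantumFieldTheory.Balaban1983to89.B9Ineq3133KernelConcrete

open Literature.MathematicalPhysics.QuantumFieldTheory.Balaban1983to89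
open Literature.MathematicalPhysics.QuantumFieldTheory.Balaban1983to89.B6RandomWalk (HasMajorant BlockSupp hasMajorant_mono Triangle254 Ineq261)
open Literature.MathematicalPhysics.QuantumFieldTheory.Balaban1983to89.B6RandomWalkHom (HasMajorantHom hasMajorantHom_mono hasMajorantHom_iff)
open Literature.MathematicalPhysics.QuantumFieldTheory.Balaban1983to89.B9Thm34Ext (toB6)
open Literature.MathematicalPhysics.QuantumFieldTheory.Balaban1983to89.B9Ineq347 (ScaleTransfer)
open Literature.MathematicalPhysics.QuantumFieldTheory.Balaban1983to89.B6RandomWalkSection (hasMajorant_id_of_ker)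
open Literature.MathematicalPhysics.QuantumFieldTheory.Balaban1983to89.B9Ineq349Hom (hasMajorantHom_rate_mono hasMajorantHom_comp_decay
  hasMajorantHom_local_comp)

/-! ## §1  The word `H = G ∘ Q* ∘ C_q` with typed letters, generic rates -/

section Word

variable {g : B9.Geometry} [Fintype g.Site] {Rr : ℝ} {H : Prop}
variable {W : Type}

/-- **(3.133), THE TWO SUP MEMBERS, FOR THE WORD `H = G·Q*·C_q`, GENERIC RATES** (p. 422 «The above inequality [(3.132)] together with Theorem 3.3 for
G … give (3.133)»): `Q*` block-local after `C_q` ([4] (2.52), no `y″`-sum), then the decaying letter `G` (resp. `X_k·G`) in front with ONE `y″`-sum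
([4] (2.54)/(2.61)) and the transfer of `(Lʲη)⁻²` (p. 398 remark); rate `ρ ≦ δ₁`, `ρ + (α+β)δ₀ ≦ δ₀`; constant `B₀κ_QC_KΛc₁(β)`; weights `(Lʲη)²·(Lʲη)⁻² = 1`
and `(Lʲη)·(Lʲη)⁻² = (Lʲη)⁻¹`.
[cite: Balaban1985BackgroundPropagators, (3.133) p.422 + (3.132) p.422 + (3.126) p.420 + Thm 3.3 p.399 + (3.42) p.397 + (3.15) p.393 + p.398 remark; Balaban1984PropagatorsII, (2.51)–(2.55) p.232 + Lemma 2.1 (2.60)–(2.61) p.234] -/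
theorem ineq3133_sup_word [DecidableEq g.Site] {KX : Type} (blk : W → g.Site) (d : ℕ) (δ₀ δ₁ α β ρ Λ κQ B₀ CK : ℝ)
    (hκQ : 0 ≤ κQ) (hB₀ : 0 ≤ B₀) (hCK : 0 ≤ CK) (hΛ : 0 ≤ Λ) (hρ : 0 ≤ ρ) (hρ₁ : ρ ≤ δ₁) (hr : ρ + (α + β) * δ₀ ≤ δ₀)
    -- the multiscale geometry 𝔅 and its axioms, [4] Lemma 2.1 at `β`, the p. 398 transfer of `(Lʲη)⁻²` at `α`
    (hdnn : ∀ a a' : g.Site, 0 ≤ g.dist a a') (htri : Triangle254 (toB6 g Rr H)) (hlen : ∀ y : g.Site, 0 < g.len y)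
    (h261 : Ineq261 d (toB6 g Rr H) δ₀ β) (hT2i : ScaleTransfer g δ₀ α Λ (fun a => (g.len a ^ 2)⁻¹))
    -- THEOREM 3.3 for `G`: (3.42)₁ and, for the left words `X_k·G`, (3.42)₂, as block majorants on the bond carrier at the rate `δ₀`
    {G : Module.End ℝ (W → ℝ)} {X : KX → Module.End ℝ (W → ℝ)}
    (hG : HasMajorant (g := toB6 g Rr H) blk G (fun a a' => B₀ * g.len a ^ 2 * Real.exp (-(δ₀ * g.dist a a'))))
    (hXG : ∀ k : KX, HasMajorant (g := toB6 g Rr H) blk (X k * G) (fun a a' => B₀ * g.len a * Real.exp (-(δ₀ * g.dist a a'))))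
    -- the (3.15) letter `Q*`: coarse lattice → bonds, block-local of size `κ_Q`
    {Qcs : (g.Site → ℝ) →ₗ[ℝ] (W → ℝ)}
    (hQcs : HasMajorantHom (g := toB6 g Rr H) (fun y : g.Site => y) blk Qcs (fun a a' : g.Site => if a = a' then κQ else 0))
    -- (3.132): the coarse operator `C_q = (QGQ*)⁻¹` with its kernel bound in the coarse pairing (`vol(y′) = (L^{j′}η)^d`) at the rate `δ₁`
    {Cq : Module.End ℝ (g.Site → ℝ)}
    (h3132 : ∀ y y' : g.Site, |B9Thm34Inv.ker (B9Thm34Inv.vol g d) Cq y y'| ≤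
      CK * g.len y ^ (-(2 : ℝ)) * g.len y' ^ (-(d : ℝ)) * Real.exp (-(δ₁ * g.dist y y'))) :
    HasMajorantHom (g := toB6 g Rr H) (fun y : g.Site => y) blk ((G : (W → ℝ) →ₗ[ℝ] (W → ℝ)) ∘ₗ Qcs ∘ₗ Cq)
        (fun a a' => (B₀ * (κQ * CK) * Λ * B6.c1 d δ₀ β) * Real.exp (-(ρ * g.dist a a'))) ∧
      (∀ k : KX, HasMajorantHom (g := toB6 g Rr H) (fun y : g.Site => y) blk (((X k * G : Module.End ℝ (W → ℝ)) : (W → ℝ) →ₗ[ℝ] (W → ℝ)) ∘ₗ Qcs ∘ₗ Cq)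
        (fun a a' => (B₀ * (κQ * CK) * Λ * B6.c1 d δ₀ β) * (g.len a)⁻¹ * Real.exp (-(ρ * g.dist a a')))) := by
  classical
  have hc1 : 0 ≤ B6.c1 d δ₀ β := B6RandomWalk.c1_nonneg d δ₀ β
  -- `C_q`: the (3.132) kernel bound read as a block majorant on 𝔅 (identity block map), then the rate lowered to `ρ`
  have hr2 : ∀ a : g.Site, g.len a ^ (-(2 : ℝ)) = (g.len a ^ 2)⁻¹ := fun a => by
    rw [Real.rpow_neg (hlen a).le, show (2 : ℝ) = ((2 : ℕ) : ℝ) by norm_num, Real.rpow_natCast]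
  have hCqM : HasMajorant (g := toB6 g Rr H) (fun y : g.Site => y) Cq (fun a a' => CK * (g.len a ^ 2)⁻¹ * Real.exp (-(δ₁ * g.dist a a'))) :=
    hasMajorant_mono (g := toB6 g Rr H) _
      (hasMajorant_id_of_ker (R := Rr) (H := H) d hlen CK (fun y => g.len y ^ (-(2 : ℝ))) (fun y y' => Real.exp (-(δ₁ * g.dist y y'))) h3132)
      fun a a' => le_of_eq (by simp only [hr2])
  have hCqH : HasMajorantHom (g := toB6 g Rr H) (fun y : g.Site => y) (fun y : g.Site => y) (Cq : (g.Site → ℝ) →ₗ[ℝ] (g.Site → ℝ))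
      (fun a a' => CK * (g.len a ^ 2)⁻¹ * Real.exp (-(δ₁ * g.dist a a'))) := (hasMajorantHom_iff (g := toB6 g Rr H) _ _ _).mpr hCqM
  -- `Q* ∘ C_q`: a block-local letter after a decaying one ([4] (2.52), no sum), rate lowered to `ρ ≦ δ₁`
  have hK0 : ∀ a a' : g.Site, 0 ≤ CK * (g.len a ^ 2)⁻¹ * Real.exp (-(δ₁ * g.dist a a')) := fun a a' =>
    mul_nonneg (mul_nonneg hCK (inv_nonneg.mpr (sq_nonneg _))) (Real.exp_nonneg _)
  have hQC0 := hasMajorantHom_local_comp (R := Rr) (H := H) (fun y : g.Site => y) (fun y : g.Site => y) blk κQ hK0 hQcs hCqH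
  have hQC1 : HasMajorantHom (g := toB6 g Rr H) (fun y : g.Site => y) blk (Qcs ∘ₗ Cq)
      (fun a a' => (κQ * CK) * (g.len a ^ 2)⁻¹ * Real.exp (-(δ₁ * g.dist a a'))) :=
    hasMajorantHom_mono (g := toB6 g Rr H) _ _ hQC0 fun a a' => le_of_eq (by ring)
  have hQC : HasMajorantHom (g := toB6 g Rr H) (fun y : g.Site => y) blk (Qcs ∘ₗ Cq)
      (fun a a' => (κQ * CK) * (g.len a ^ 2)⁻¹ * Real.exp (-(ρ * g.dist a a'))) :=
    hasMajorantHom_rate_mono (R := Rr) (H := H) _ _ (κQ * CK) (fun a => (g.len a ^ 2)⁻¹) (mul_nonneg hκQ hCK)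
      (fun a => inv_nonneg.mpr (sq_nonneg _)) hρ₁ hdnn hQC1
  -- weights
  have hw2 : ∀ a : g.Site, 0 ≤ g.len a ^ 2 := fun a => sq_nonneg _
  have hw2i : ∀ a : g.Site, 0 ≤ (g.len a ^ 2)⁻¹ := fun a => inv_nonneg.mpr (sq_nonneg _)
  have i1 : ∀ a : g.Site, g.len a ^ 2 * (g.len a ^ 2)⁻¹ = 1 := fun a => mul_inv_cancel₀ (pow_ne_zero 2 (hlen a).ne')
  have i2 : ∀ a : g.Site, g.len a * (g.len a ^ 2)⁻¹ = (g.len a)⁻¹ := fun a => by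
    have hℓ : g.len a ≠ 0 := (hlen a).ne'
    field_simp
  refine ⟨?_, fun k => ?_⟩
  · -- `H = G ∘ (Q* ∘ C_q)`: ONE decaying composition
    have hGH : HasMajorantHom (g := toB6 g Rr H) blk blk (G : (W → ℝ) →ₗ[ℝ] (W → ℝ))
        (fun a a' => B₀ * g.len a ^ 2 * Real.exp (-(δ₀ * g.dist a a'))) := (hasMajorantHom_iff (g := toB6 g Rr H) _ _ _).mpr hG
    have hcmp := hasMajorantHom_comp_decay (R := Rr) (H := H) (fun y : g.Site => y) blk blk d δ₀ α β ρ δ₀ Λ B₀ (κQ * CK)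
      (fun a => g.len a ^ 2) (fun a => (g.len a ^ 2)⁻¹) hw2 hw2i hΛ hB₀ (mul_nonneg hκQ hCK) hρ hr hdnn htri hT2i h261 hGH hQC
    refine hasMajorantHom_mono (g := toB6 g Rr H) _ _ hcmp fun a a' => le_of_eq ?_
    rw [i1 a]
    ring
  · -- `X_k·H = (X_k·G) ∘ (Q* ∘ C_q)`
    have hXH : HasMajorantHom (g := toB6 g Rr H) blk blk (((X k * G : Module.End ℝ (W → ℝ)) : (W → ℝ) →ₗ[ℝ] (W → ℝ)))
        (fun a a' => B₀ * g.len a * Real.exp (-(δ₀ * g.dist a a'))) := (hasMajorantHom_iff (g := toB6 g Rr H) _ _ _).mpr (hXG k)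
    have hcmp := hasMajorantHom_comp_decay (R := Rr) (H := H) (fun y : g.Site => y) blk blk d δ₀ α β ρ δ₀ Λ B₀ (κQ * CK)
      (fun a => g.len a) (fun a => (g.len a ^ 2)⁻¹) (fun a => (hlen a).le) hw2i hΛ hB₀ (mul_nonneg hκQ hCK) hρ hr hdnn htri hT2i h261 hXH hQC
    refine hasMajorantHom_mono (g := toB6 g Rr H) _ _ hcmp fun a a' => le_of_eq ?_
    rw [i2 a]

end Word

/-! ## §2  The printed rate `(1/2)δ₁` and the printed entries -/

section Printed

variable {g : B9.Geometry} [Fintype g.Site] {Rr : ℝ} {H : Prop}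
variable {W : Type}

/-- **(3.133), THE TWO SUP MEMBERS, AT THE PRINTED RATE `(1/2)δ₁`** (p. 422): for `0 < δ₁ ≦ δ₀`, from Theorem 3.3's (3.42)₁,₂ for `G` (block majorants,
rate `δ₀`), the block-local (3.15) letter `Q*` (size `κ_Q`) and the (3.132) kernel bound for `C_q = (QGQ*)⁻¹` (rate `δ₁`), [4] Lemma 2.1 «for every
0 < α < 1» and the p. 398 transfers for every exponent: `∃ K ≧ 0` such that the word `H = G ∘ Q* ∘ C_q` and the words `X_k·G ∘ Q* ∘ C_q` have the block
majorants `K·e^{−(δ₁/2)d}`, `K·(Lʲη)⁻¹·e^{−(δ₁/2)d}`, and hence the ENTRY bounds `|(G Q* C_q 1_{y′})(q)| ≦ K·e^{−(δ₁/2)d(y(q),y′)}`,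
`|(X_kG Q* C_q 1_{y′})(q)| ≦ K·(Lʲη)⁻¹·e^{−(δ₁/2)d(y(q),y′)}` — in the coarse pairing of `B9Thm34Inv.ker (vol g d)` (divide by `vol(y′) = (L^{j′}η)^d`)
the printed `|H(x,y′)|, |∇H(x,y′)| ≦ O(1)[1, (Lʲη)⁻¹](L^{j′}η)^{−d}e^{−(1/2)δ₁d(y,y′)}`.  Exponents `α = β = 1/4`: `δ₁/2 + δ₀/2 ≦ δ₀`.
[cite: Balaban1985BackgroundPropagators, (3.133) p.422 + (3.132) p.422 + (3.126) p.420 + Thm 3.3 p.399 + (3.42) p.397 + (3.15) p.393 + p.398 remark; Balaban1984PropagatorsII, (2.51)–(2.55) p.232 + Lemma 2.1 (2.60)–(2.61) p.234] -/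
theorem ineq3133_sup_printed [DecidableEq g.Site] {KX : Type} (blk : W → g.Site) (d : ℕ) (δ₀ δ₁ κQ B₀ CK : ℝ)
    (hκQ : 0 ≤ κQ) (hB₀ : 0 ≤ B₀) (hCK : 0 ≤ CK) (hδ₁ : 0 < δ₁) (hδ₁₀ : δ₁ ≤ δ₀)
    -- the multiscale geometry 𝔅 and its axioms
    (hdnn : ∀ a a' : g.Site, 0 ≤ g.dist a a') (htri : Triangle254 (toB6 g Rr H)) (hlen : ∀ y : g.Site, 0 < g.len y)
    -- [4] Lemma 2.1 (2.61) at the rate `δ₀`, «for every 0 < α < 1», and the p. 398 scale transfer for every exponent (the lineage's shapes)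
    (h261 : ∀ α : ℝ, 0 < α → α < 1 → Ineq261 d (toB6 g Rr H) δ₀ α)
    (hST : ∀ α : ℝ, 0 < α → ∃ Λ : ℝ, 1 ≤ Λ ∧ ScaleTransfer g δ₀ α Λ (fun a => g.len a) ∧ ScaleTransfer g δ₀ α Λ (fun a => g.len a ^ 2) ∧
      ScaleTransfer g δ₀ α Λ (fun a => (g.len a)⁻¹) ∧ ScaleTransfer g δ₀ α Λ (fun a => (g.len a ^ 2)⁻¹) ∧
      ScaleTransfer g δ₀ α Λ (fun a => (g.len a ^ 4)⁻¹) ∧ ScaleTransfer g δ₀ α Λ (fun y => g.len y ^ (-(4 : ℝ))))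
    -- THEOREM 3.3 for `G`: (3.42)₁ and (3.42)₂ (left words `X_k·G`) as block majorants at the rate `δ₀`
    {G : Module.End ℝ (W → ℝ)} {X : KX → Module.End ℝ (W → ℝ)}
    (hG : HasMajorant (g := toB6 g Rr H) blk G (fun a a' => B₀ * g.len a ^ 2 * Real.exp (-(δ₀ * g.dist a a'))))
    (hXG : ∀ k : KX, HasMajorant (g := toB6 g Rr H) blk (X k * G) (fun a a' => B₀ * g.len a * Real.exp (-(δ₀ * g.dist a a'))))
    -- the (3.15) letter `Q*` (coarse lattice → bonds, block-local of size `κ_Q`)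
    {Qcs : (g.Site → ℝ) →ₗ[ℝ] (W → ℝ)}
    (hQcs : HasMajorantHom (g := toB6 g Rr H) (fun y : g.Site => y) blk Qcs (fun a a' : g.Site => if a = a' then κQ else 0))
    -- (3.132) for `C_q = (QGQ*)⁻¹` in the coarse pairing, rate `δ₁`
    {Cq : Module.End ℝ (g.Site → ℝ)}
    (h3132 : ∀ y y' : g.Site, |B9Thm34Inv.ker (B9Thm34Inv.vol g d) Cq y y'| ≤
      CK * g.len y ^ (-(2 : ℝ)) * g.len y' ^ (-(d : ℝ)) * Real.exp (-(δ₁ * g.dist y y'))) :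
    ∃ K : ℝ, 0 ≤ K ∧
      HasMajorantHom (g := toB6 g Rr H) (fun y : g.Site => y) blk ((G : (W → ℝ) →ₗ[ℝ] (W → ℝ)) ∘ₗ Qcs ∘ₗ Cq)
        (fun a a' => K * Real.exp (-(δ₁ / 2 * g.dist a a'))) ∧
      (∀ k : KX, HasMajorantHom (g := toB6 g Rr H) (fun y : g.Site => y) blk (((X k * G : Module.End ℝ (W → ℝ)) : (W → ℝ) →ₗ[ℝ] (W → ℝ)) ∘ₗ Qcs ∘ₗ Cq)
        (fun a a' => K * (g.len a)⁻¹ * Real.exp (-(δ₁ / 2 * g.dist a a')))) ∧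
      (∀ (q : W) (y' : g.Site), |G (Qcs (Cq (Pi.single y' 1))) q| ≤ K * Real.exp (-(δ₁ / 2 * g.dist (blk q) y'))) ∧
      (∀ (k : KX) (q : W) (y' : g.Site), |(X k * G) (Qcs (Cq (Pi.single y' 1))) q| ≤
        K * (g.len (blk q))⁻¹ * Real.exp (-(δ₁ / 2 * g.dist (blk q) y'))) := by
  classical
  obtain ⟨Λ, hΛ1, -, -, -, hT2i, -, -⟩ := hST (1 / 4) (by norm_num)
  have hΛ0 : 0 ≤ Λ := zero_le_one.trans hΛ1
  have h261β : Ineq261 d (toB6 g Rr H) δ₀ (1 / 4) := h261 _ (by norm_num) (by norm_num)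
  have hc1 : 0 ≤ B6.c1 d δ₀ (1 / 4) := B6RandomWalk.c1_nonneg d δ₀ (1 / 4)
  have hρ0 : 0 ≤ δ₁ / 2 := by linarith
  have hρ1 : δ₁ / 2 ≤ δ₁ := by linarith
  have hr : δ₁ / 2 + (1 / 4 + 1 / 4) * δ₀ ≤ δ₀ := by linarith
  obtain ⟨h1, h2⟩ := ineq3133_sup_word (Rr := Rr) (H := H) blk d δ₀ δ₁ (1 / 4) (1 / 4) (δ₁ / 2) Λ κQ B₀ CK hκQ hB₀ hCK hΛ0 hρ0 hρ1 hr
    hdnn htri hlen h261β hT2i hG hXG hQcs h3132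
  have hK : 0 ≤ B₀ * (κQ * CK) * Λ * B6.c1 d δ₀ (1 / 4) := by positivity
  -- the indicator of the single coarse site `y′` is a block vector of size `1` (identity block map on 𝔅)
  have hδ : ∀ y' : g.Site, BlockSupp (g := toB6 g Rr H) (fun y : g.Site => y) (Pi.single y' (1 : ℝ)) y' 1 := fun y' =>
    ⟨zero_le_one, fun x (hx : x = y') => by rw [hx]; simp, fun x (hx : x ≠ y') => by simp [hx]⟩
  refine ⟨_, hK, h1, h2, fun q y' => ?_, fun k q y' => ?_⟩
  · have h := h1 y' (Pi.single y' 1) 1 (hδ y') q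
    simpa only [LinearMap.comp_apply, mul_one] using h
  · have h := h2 k y' (Pi.single y' 1) 1 (hδ y') q
    simpa only [LinearMap.comp_apply, mul_one] using h

end Printed

/-! ## §3  (v1.1, append-only) The literal `H` of (3.109)–(3.110): the additional factor `(L^{j′}η)⁻¹` -/

section Literal

variable {g : B9.Geometry} [Fintype g.Site] {Rr : ℝ} {H : Prop}
variable {W : Type}

/-- **THE SENTENCE AFTER (3.133)** (p. 422 [PDF 34]): «These inequalities are for the operator H given by the formula (3.126). If we want to have H giving
solutions of the variational problems (3.109), (3.110), then we have to include the additional factor (L^{j′}η)⁻¹ in this formula, and we get (3.133) with an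
additional factor (Lʲη)⁻¹, or (L^{j′}η)⁻¹, on the right-hand side.» — THE `(L^{j′}η)⁻¹` VARIANT of the two sup members: for ANY coarse operator `D` acting as the
diagonal factor `(Df)(y′) = (L^{j′}η)⁻¹f(y′)`, the literal `H_lit = G ∘ Q* ∘ C_q ∘ D` and the words `X_k·G ∘ Q* ∘ C_q ∘ D` obey the entry bounds of
`ineq3133_sup_printed` with the additional factor `(L^{j′}η)⁻¹ = (g.len y′)⁻¹` and the same `K` (the column of `H_lit` at `y′` is `(L^{j′}η)⁻¹` times the column
of `H`).  The «(Lʲη)⁻¹» alternative is print's p. 398 transfer (it costs rate) and is not asserted here.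
[cite: Balaban1985BackgroundPropagators, p.422 (the sentence after (3.133)) + (3.126) p.420 + (3.109)–(3.110) p.417] -/
theorem ineq3133_sup_literal [DecidableEq g.Site] {KX : Type} (blk : W → g.Site) (d : ℕ) (δ₀ δ₁ κQ B₀ CK : ℝ)
    (hκQ : 0 ≤ κQ) (hB₀ : 0 ≤ B₀) (hCK : 0 ≤ CK) (hδ₁ : 0 < δ₁) (hδ₁₀ : δ₁ ≤ δ₀)
    (hdnn : ∀ a a' : g.Site, 0 ≤ g.dist a a') (htri : Triangle254 (toB6 g Rr H)) (hlen : ∀ y : g.Site, 0 < g.len y)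
    (h261 : ∀ α : ℝ, 0 < α → α < 1 → Ineq261 d (toB6 g Rr H) δ₀ α)
    (hST : ∀ α : ℝ, 0 < α → ∃ Λ : ℝ, 1 ≤ Λ ∧ ScaleTransfer g δ₀ α Λ (fun a => g.len a) ∧ ScaleTransfer g δ₀ α Λ (fun a => g.len a ^ 2) ∧
      ScaleTransfer g δ₀ α Λ (fun a => (g.len a)⁻¹) ∧ ScaleTransfer g δ₀ α Λ (fun a => (g.len a ^ 2)⁻¹) ∧
      ScaleTransfer g δ₀ α Λ (fun a => (g.len a ^ 4)⁻¹) ∧ ScaleTransfer g δ₀ α Λ (fun y => g.len y ^ (-(4 : ℝ))))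
    {G : Module.End ℝ (W → ℝ)} {X : KX → Module.End ℝ (W → ℝ)}
    (hG : HasMajorant (g := toB6 g Rr H) blk G (fun a a' => B₀ * g.len a ^ 2 * Real.exp (-(δ₀ * g.dist a a'))))
    (hXG : ∀ k : KX, HasMajorant (g := toB6 g Rr H) blk (X k * G) (fun a a' => B₀ * g.len a * Real.exp (-(δ₀ * g.dist a a'))))
    {Qcs : (g.Site → ℝ) →ₗ[ℝ] (W → ℝ)}
    (hQcs : HasMajorantHom (g := toB6 g Rr H) (fun y : g.Site => y) blk Qcs (fun a a' : g.Site => if a = a' then κQ else 0))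
    {Cq : Module.End ℝ (g.Site → ℝ)}
    (h3132 : ∀ y y' : g.Site, |B9Thm34Inv.ker (B9Thm34Inv.vol g d) Cq y y'| ≤
      CK * g.len y ^ (-(2 : ℝ)) * g.len y' ^ (-(d : ℝ)) * Real.exp (-(δ₁ * g.dist y y')))
    -- the additional factor `(L^{j′}η)⁻¹` of the literal `H` of (3.109)–(3.110): any `D` acting as that diagonal
    (D : Module.End ℝ (g.Site → ℝ)) (hD : ∀ (f : g.Site → ℝ) (y : g.Site), D f y = (g.len y)⁻¹ * f y) :
    ∃ K : ℝ, 0 ≤ K ∧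
      (∀ (q : W) (y' : g.Site), |G (Qcs (Cq (D (Pi.single y' 1)))) q| ≤ K * (g.len y')⁻¹ * Real.exp (-(δ₁ / 2 * g.dist (blk q) y'))) ∧
      (∀ (k : KX) (q : W) (y' : g.Site), |(X k * G) (Qcs (Cq (D (Pi.single y' 1)))) q| ≤
        K * (g.len (blk q))⁻¹ * (g.len y')⁻¹ * Real.exp (-(δ₁ / 2 * g.dist (blk q) y'))) := by
  classical
  obtain ⟨K, hK, -, -, h3, h4⟩ := ineq3133_sup_printed (Rr := Rr) (H := H) blk d δ₀ δ₁ κQ B₀ CK hκQ hB₀ hCK hδ₁ hδ₁₀ hdnn htri hlen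
    h261 hST hG hXG hQcs h3132
  -- the column of `D` at `y′` is `(L^{j′}η)⁻¹` times the indicator of `y′`
  have hDs : ∀ y' : g.Site, D (Pi.single y' 1) = (g.len y')⁻¹ • (Pi.single y' (1 : ℝ) : g.Site → ℝ) := fun y' => by
    funext y
    rw [hD, Pi.smul_apply, smul_eq_mul]
    by_cases h : y = y'
    · subst h
      rfl
    · simp [Pi.single_eq_of_ne h]
  have hℓ : ∀ y' : g.Site, 0 ≤ (g.len y')⁻¹ := fun y' => inv_nonneg.mpr (hlen y').le
  refine ⟨K, hK, fun q y' => ?_, fun k q y' => ?_⟩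
  · have h := mul_le_mul_of_nonneg_left (h3 q y') (hℓ y')
    calc |G (Qcs (Cq (D (Pi.single y' 1)))) q| = (g.len y')⁻¹ * |G (Qcs (Cq (Pi.single y' 1))) q| := by
          simp only [hDs, map_smul, Pi.smul_apply, smul_eq_mul, abs_mul, abs_of_nonneg (hℓ y')]
      _ ≤ (g.len y')⁻¹ * (K * Real.exp (-(δ₁ / 2 * g.dist (blk q) y'))) := h
      _ = K * (g.len y')⁻¹ * Real.exp (-(δ₁ / 2 * g.dist (blk q) y')) := by ring
  · have h := mul_le_mul_of_nonneg_left (h4 k q y') (hℓ y')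
    calc |(X k * G) (Qcs (Cq (D (Pi.single y' 1)))) q| = (g.len y')⁻¹ * |(X k * G) (Qcs (Cq (Pi.single y' 1))) q| := by
          simp only [hDs, map_smul, Pi.smul_apply, smul_eq_mul, abs_mul, abs_of_nonneg (hℓ y')]
      _ ≤ (g.len y')⁻¹ * (K * (g.len (blk q))⁻¹ * Real.exp (-(δ₁ / 2 * g.dist (blk q) y'))) := h
      _ = K * (g.len (blk q))⁻¹ * (g.len y')⁻¹ * Real.exp (-(δ₁ / 2 * g.dist (blk q) y')) := by ring

end Literal

/-! ## §4  (v1.1, append-only) §2 on the lineage's bond carrier with its covariant difference letters -/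

section Lineage

open Literature.MathematicalPhysics.QuantumFieldTheory.Balaban1983to89.B9Eq352DivFormLetters (conj)
open Literature.MathematicalPhysics.QuantumFieldTheory.Balaban1983to89.B9Eq352GradLetters (diffLetter)
open Literature.MathematicalPhysics.QuantumFieldTheory.Balaban1983to89.B9Eq371GradLetters (bT bU)

variable {g : B9.Geometry} [Fintype g.Site] {Rr : ℝ} {H : Prop}
variable {𝔸 : Type*} [NormedRing 𝔸] [NormedAlgebra ℂ 𝔸] {ι : Type} [Fintype ι] (b : Module.Basis ι ℝ 𝔸)
variable {S : Type} {κ : Type} (T : κ → Equiv.Perm S) (U : κ → S → 𝔸ˣ)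

/-- **(3.133)₁,₂ ON THE LINEAGE'S BOND CARRIER** (p. 422; (3.3)/(3.8)/(3.52) for the letters): §2 with `W = (κ × S) × ι` (bond functions in the real
coordinates of `b`, block map `q ↦ blk q.1.2` as in the Sect. B files) and the covariant difference letters `X_k = ∇_k = conj b (diffLetter (bT T) (bU U) η⁻¹ k)`,
`k : κ ⊕ κ` (forward `η⁻¹D_μ` / backward `−η⁻¹D*_μ` along the bonds of the star, background `U` on the bond carrier): the hypotheses `hG`/`hDG` are the
Theorem-3.3 hypotheses `hG`/`hDG` of `B9Ineq346L2RightDiffG.thm34_G_l2_right_final` VERBATIM; conclusion = `ineq3133_sup_printed`'s, for these letters.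
An instantiation (no further hypothesis).
[cite: Balaban1985BackgroundPropagators, (3.133) p.422 + (3.3) p.390 + (3.8) p.392 + Thm 3.3 p.399; Balaban1984PropagatorsII, (2.51) p.232] -/
theorem ineq3133_sup_printed_lineage [DecidableEq g.Site] (blk : S → g.Site) (d : ℕ) (δ₀ δ₁ κQ B₀ CK : ℝ)
    (hκQ : 0 ≤ κQ) (hB₀ : 0 ≤ B₀) (hCK : 0 ≤ CK) (hδ₁ : 0 < δ₁) (hδ₁₀ : δ₁ ≤ δ₀)
    (hdnn : ∀ a a' : g.Site, 0 ≤ g.dist a a') (htri : Triangle254 (toB6 g Rr H)) (hlen : ∀ y : g.Site, 0 < g.len y)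
    (h261 : ∀ α : ℝ, 0 < α → α < 1 → Ineq261 d (toB6 g Rr H) δ₀ α)
    (hST : ∀ α : ℝ, 0 < α → ∃ Λ : ℝ, 1 ≤ Λ ∧ ScaleTransfer g δ₀ α Λ (fun a => g.len a) ∧ ScaleTransfer g δ₀ α Λ (fun a => g.len a ^ 2) ∧
      ScaleTransfer g δ₀ α Λ (fun a => (g.len a)⁻¹) ∧ ScaleTransfer g δ₀ α Λ (fun a => (g.len a ^ 2)⁻¹) ∧
      ScaleTransfer g δ₀ α Λ (fun a => (g.len a ^ 4)⁻¹) ∧ ScaleTransfer g δ₀ α Λ (fun y => g.len y ^ (-(4 : ℝ))))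
    -- THEOREM 3.3 for `G(U)` on the bond carrier: (3.42)₁ and (3.42)₂ with the lineage's `∇_k` (= `hG`/`hDG` of `B9Ineq346L2RightDiffG`)
    {G : Module.End ℝ ((κ × S) × ι → ℝ)}
    (hG : HasMajorant (g := toB6 g Rr H) (fun q : (κ × S) × ι => blk q.1.2) G
      (fun a a' => B₀ * g.len a ^ 2 * Real.exp (-(δ₀ * g.dist a a'))))
    (hDG : ∀ k : κ ⊕ κ, HasMajorant (g := toB6 g Rr H) (fun q : (κ × S) × ι => blk q.1.2)
      (conj b (diffLetter (bT T) (bU U) ((g.eta : ℂ)⁻¹) k) * G) (fun a a' => B₀ * g.len a * Real.exp (-(δ₀ * g.dist a a'))))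
    -- the (3.15) letter `Q*` (coarse lattice → bonds) and (3.132) for `C_q = (QGQ*)⁻¹`
    {Qcs : (g.Site → ℝ) →ₗ[ℝ] ((κ × S) × ι → ℝ)}
    (hQcs : HasMajorantHom (g := toB6 g Rr H) (fun y : g.Site => y) (fun q : (κ × S) × ι => blk q.1.2) Qcs
      (fun a a' : g.Site => if a = a' then κQ else 0))
    {Cq : Module.End ℝ (g.Site → ℝ)}
    (h3132 : ∀ y y' : g.Site, |B9Thm34Inv.ker (B9Thm34Inv.vol g d) Cq y y'| ≤
      CK * g.len y ^ (-(2 : ℝ)) * g.len y' ^ (-(d : ℝ)) * Real.exp (-(δ₁ * g.dist y y'))) :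
    ∃ K : ℝ, 0 ≤ K ∧
      HasMajorantHom (g := toB6 g Rr H) (fun y : g.Site => y) (fun q : (κ × S) × ι => blk q.1.2)
        ((G : ((κ × S) × ι → ℝ) →ₗ[ℝ] ((κ × S) × ι → ℝ)) ∘ₗ Qcs ∘ₗ Cq) (fun a a' => K * Real.exp (-(δ₁ / 2 * g.dist a a'))) ∧
      (∀ k : κ ⊕ κ, HasMajorantHom (g := toB6 g Rr H) (fun y : g.Site => y) (fun q : (κ × S) × ι => blk q.1.2)
        (((conj b (diffLetter (bT T) (bU U) ((g.eta : ℂ)⁻¹) k) * G : Module.End ℝ ((κ × S) × ι → ℝ)) :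
          ((κ × S) × ι → ℝ) →ₗ[ℝ] ((κ × S) × ι → ℝ)) ∘ₗ Qcs ∘ₗ Cq)
        (fun a a' => K * (g.len a)⁻¹ * Real.exp (-(δ₁ / 2 * g.dist a a')))) ∧
      (∀ (q : (κ × S) × ι) (y' : g.Site), |G (Qcs (Cq (Pi.single y' 1))) q| ≤ K * Real.exp (-(δ₁ / 2 * g.dist (blk q.1.2) y'))) ∧
      (∀ (k : κ ⊕ κ) (q : (κ × S) × ι) (y' : g.Site), |(conj b (diffLetter (bT T) (bU U) ((g.eta : ℂ)⁻¹) k) * G) (Qcs (Cq (Pi.single y' 1))) q| ≤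
        K * (g.len (blk q.1.2))⁻¹ * Real.exp (-(δ₁ / 2 * g.dist (blk q.1.2) y'))) :=
  ineq3133_sup_printed (Rr := Rr) (H := H) (fun q : (κ × S) × ι => blk q.1.2) d δ₀ δ₁ κQ B₀ CK hκQ hB₀ hCK hδ₁ hδ₁₀ hdnn htri hlen h261 hST
    (X := fun k : κ ⊕ κ => conj b (diffLetter (bT T) (bU U) ((g.eta : ℂ)⁻¹) k)) hG hDG hQcs h3132

end Lineage

/-! ## §5  The summed form: an `ℓ^∞ → ℓ^∞` operator bound for the word `H = G ∘ Q* ∘ C_q` and for `X_k·H`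
(lit-balaban desk IR-NE7-G118-1, 2026-08-31).  Print displays NO summed sup → sup inequality for `H` (p. 422 has the
KERNEL estimate (3.133) and, after (3.136), one row-sum instance for `H*J` under the regularity (3.36) of `J`); the
summed form below is (3.133)'s two sup members — exactly the block majorants DELIVERED by `ineq3133_sup_printed` —
summed over `y′` with [4] Lemma 2.1 (2.61) at `α := δ₁/(2δ₀)` (so that `αδ₀ = δ₁/2`), i.e. the two-space twin of
`B9Eq360Vprime.abs_apply_le_rowSum_of_hasMajorant` / `opBound_of_363_261`.  Same hypotheses as `ineq3133_sup_printed`;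
nothing of (3.133) / Theorem 3.3 / (3.132) is asserted; no new definition. -/

section SupOperator

variable {g : B9.Geometry} [Fintype g.Site] {Rr : ℝ} {H : Prop}
variable {W : Type}

/-- **Two-space block majorant ⟹ sup-norm bound** (the `HasMajorantHom` twin of
`B9Eq360Vprime.abs_apply_le_rowSum_of_hasMajorant`): if `T : (coarse sites) → (bonds)` has the block majorant `K`
(`|(Tμ)(v)| ≦ K(y(v), y′)·B` for `supp μ ⊂ {y′}`, `|μ| ≦ B`), then for an ARBITRARY `μ` (decomposed into its block
pieces, Σ_{y′} Δ(y′) = I) `|(Tμ)(v)| ≦ (Σ_{y′} K(y(v), y′))·‖μ‖_∞`.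
[cite: Balaban1984PropagatorsII, (2.51)–(2.52) p.232; Balaban1985BackgroundPropagators, (3.133) p.422] -/
theorem abs_apply_le_rowSum_of_hasMajorantHom (blk : W → g.Site) {T : (g.Site → ℝ) →ₗ[ℝ] (W → ℝ)}
    {K : g.Site → g.Site → ℝ} (hK : HasMajorantHom (g := toB6 g Rr H) (fun y : g.Site => y) blk T K)
    (μ : g.Site → ℝ) (v : W) :
    |T μ v| ≤ (∑ y' : g.Site, K (blk v) y') * ‖μ‖ := by
  classical
  have hpiece : ∀ y' : g.Site,
      |T (B6RandomWalk.blockPiece (g := toB6 g Rr H) (fun y : g.Site => y) y' μ) v| ≤ K (blk v) y' * ‖μ‖ := fun y' =>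
    hK y' _ _ (B6RandomWalk.blockSupp_blockPiece (g := toB6 g Rr H) (fun y : g.Site => y) μ y' ‖μ‖ (norm_nonneg _)
      (fun x _ => by rw [← Real.norm_eq_abs]; exact norm_le_pi_norm μ x)) v
  conv_lhs => rw [← B6RandomWalk.sum_blockPiece (g := toB6 g Rr H) (fun y : g.Site => y) μ, map_sum, Finset.sum_apply]
  rw [Finset.sum_mul]
  exact (Finset.abs_sum_le_sum_abs _ _).trans (Finset.sum_le_sum fun y' _ => hpiece y')

/-- **(3.133) SUMMED OVER `y′`: THE `ℓ^∞ → ℓ^∞` BOUNDS `sup_q |(H μ)(q)| ≦ K′·sup_{y′} |μ(y′)|` AND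
`sup_q |(X_k H μ)(q)| ≦ K′·(Lʲη)⁻¹·sup_{y′} |μ(y′)|` FOR THE WORD `H = G ∘ Q* ∘ C_q` OF (3.126)** (p. 420 «HB = GQ*(QGQ*)⁻¹B»),
under exactly the hypotheses of `ineq3133_sup_printed` (Theorem 3.3's (3.42)₁,₂ block majorants for `G` and `X_k·G` at the
rate `δ₀`, the block-local (3.15) letter `Q*`, the (3.132) kernel bound for `C_q = (QGQ*)⁻¹` at the rate `δ₁ ≦ δ₀`, [4] Lemma 2.1
(2.61) «for every 0 < α < 1», the p. 398 transfers): the two block majorants `K·e^{−(δ₁/2)d}`, `K·(Lʲη)⁻¹·e^{−(δ₁/2)d}` of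
`ineq3133_sup_printed`, summed over `y′` with (2.61) at `α = δ₁/(2δ₀)`, give `K′ = K·c₁(δ₁/(2δ₀))`.  (For the `H` solving the
variational problems (3.109)–(3.110) print adds «the additional factor (L^{j′}η)⁻¹ … or (L^jη)⁻¹, on the right-hand side»,
p. 422 — a scalar rider, not typed here.)
[cite: Balaban1985BackgroundPropagators, (3.133) p.422 + (3.126) p.420 + Thm 3.3 p.399 + (3.132) p.422; Balaban1984PropagatorsII, Lemma 2.1 (2.61) p.234 + (2.51)–(2.52) p.232] -/
theorem ineq3133_sup_operator [DecidableEq g.Site] {KX : Type} (blk : W → g.Site) (d : ℕ) (δ₀ δ₁ κQ B₀ CK : ℝ)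
    (hκQ : 0 ≤ κQ) (hB₀ : 0 ≤ B₀) (hCK : 0 ≤ CK) (hδ₁ : 0 < δ₁) (hδ₁₀ : δ₁ ≤ δ₀)
    (hdnn : ∀ a a' : g.Site, 0 ≤ g.dist a a') (htri : Triangle254 (toB6 g Rr H)) (hlen : ∀ y : g.Site, 0 < g.len y)
    (h261 : ∀ α : ℝ, 0 < α → α < 1 → Ineq261 d (toB6 g Rr H) δ₀ α)
    (hST : ∀ α : ℝ, 0 < α → ∃ Λ : ℝ, 1 ≤ Λ ∧ ScaleTransfer g δ₀ α Λ (fun a => g.len a) ∧ ScaleTransfer g δ₀ α Λ (fun a => g.len a ^ 2) ∧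
      ScaleTransfer g δ₀ α Λ (fun a => (g.len a)⁻¹) ∧ ScaleTransfer g δ₀ α Λ (fun a => (g.len a ^ 2)⁻¹) ∧
      ScaleTransfer g δ₀ α Λ (fun a => (g.len a ^ 4)⁻¹) ∧ ScaleTransfer g δ₀ α Λ (fun y => g.len y ^ (-(4 : ℝ))))
    {G : Module.End ℝ (W → ℝ)} {X : KX → Module.End ℝ (W → ℝ)}
    (hG : HasMajorant (g := toB6 g Rr H) blk G (fun a a' => B₀ * g.len a ^ 2 * Real.exp (-(δ₀ * g.dist a a'))))
    (hXG : ∀ k : KX, HasMajorant (g := toB6 g Rr H) blk (X k * G) (fun a a' => B₀ * g.len a * Real.exp (-(δ₀ * g.dist a a'))))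
    {Qcs : (g.Site → ℝ) →ₗ[ℝ] (W → ℝ)}
    (hQcs : HasMajorantHom (g := toB6 g Rr H) (fun y : g.Site => y) blk Qcs (fun a a' : g.Site => if a = a' then κQ else 0))
    {Cq : Module.End ℝ (g.Site → ℝ)}
    (h3132 : ∀ y y' : g.Site, |B9Thm34Inv.ker (B9Thm34Inv.vol g d) Cq y y'| ≤
      CK * g.len y ^ (-(2 : ℝ)) * g.len y' ^ (-(d : ℝ)) * Real.exp (-(δ₁ * g.dist y y'))) :
    ∃ K' : ℝ, 0 ≤ K' ∧
      (∀ (μ : g.Site → ℝ) (q : W), |G (Qcs (Cq μ)) q| ≤ K' * ‖μ‖) ∧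
      (∀ (k : KX) (μ : g.Site → ℝ) (q : W), |(X k * G) (Qcs (Cq μ)) q| ≤ K' * (g.len (blk q))⁻¹ * ‖μ‖) := by
  classical
  obtain ⟨K, hK, h1, h2, -, -⟩ := ineq3133_sup_printed (Rr := Rr) (H := H) blk d δ₀ δ₁ κQ B₀ CK hκQ hB₀ hCK hδ₁ hδ₁₀
    hdnn htri hlen h261 hST hG hXG hQcs h3132
  -- [4] Lemma 2.1 (2.61) at `α := δ₁/(2δ₀)`: `αδ₀ = δ₁/2`, `0 < α ≦ 1/2 < 1`
  have hδ₀ : 0 < δ₀ := lt_of_lt_of_le hδ₁ hδ₁₀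
  have hα0 : 0 < δ₁ / (2 * δ₀) := by positivity
  have hα1 : δ₁ / (2 * δ₀) < 1 := by
    rw [div_lt_one (by positivity)]
    linarith
  have hαδ : δ₁ / (2 * δ₀) * δ₀ = δ₁ / 2 := by
    field_simp
  have hrow : ∀ y : g.Site, ∑ y' : g.Site, Real.exp (-(δ₁ / 2 * g.dist y y')) ≤ B6.c1 d δ₀ (δ₁ / (2 * δ₀)) := by
    intro y
    have h : ∑ y' : g.Site, Real.exp (-(δ₁ / (2 * δ₀) * δ₀ * g.dist y y')) ≤ B6.c1 d δ₀ (δ₁ / (2 * δ₀)) :=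
      h261 _ hα0 hα1 y
    simpa only [hαδ] using h
  have hc1 : 0 ≤ B6.c1 d δ₀ (δ₁ / (2 * δ₀)) := B6RandomWalk.c1_nonneg d δ₀ _
  refine ⟨K * B6.c1 d δ₀ (δ₁ / (2 * δ₀)), mul_nonneg hK hc1, fun μ q => ?_, fun k μ q => ?_⟩
  · have h := abs_apply_le_rowSum_of_hasMajorantHom (Rr := Rr) (H := H) blk h1 μ q
    simp only [LinearMap.comp_apply] at h
    calc |G (Qcs (Cq μ)) q| ≤ (∑ y' : g.Site, K * Real.exp (-(δ₁ / 2 * g.dist (blk q) y'))) * ‖μ‖ := h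
      _ = K * (∑ y' : g.Site, Real.exp (-(δ₁ / 2 * g.dist (blk q) y'))) * ‖μ‖ := by rw [Finset.mul_sum]
      _ ≤ K * B6.c1 d δ₀ (δ₁ / (2 * δ₀)) * ‖μ‖ :=
          mul_le_mul_of_nonneg_right (mul_le_mul_of_nonneg_left (hrow (blk q)) hK) (norm_nonneg _)
  · have h := abs_apply_le_rowSum_of_hasMajorantHom (Rr := Rr) (H := H) blk (h2 k) μ q
    simp only [LinearMap.comp_apply] at h
    have hKl : 0 ≤ K * (g.len (blk q))⁻¹ := mul_nonneg hK (inv_nonneg.mpr (hlen _).le)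
    calc |(X k * G) (Qcs (Cq μ)) q|
        ≤ (∑ y' : g.Site, K * (g.len (blk q))⁻¹ * Real.exp (-(δ₁ / 2 * g.dist (blk q) y'))) * ‖μ‖ := h
      _ = K * (g.len (blk q))⁻¹ * (∑ y' : g.Site, Real.exp (-(δ₁ / 2 * g.dist (blk q) y'))) * ‖μ‖ := by
          rw [Finset.mul_sum]
      _ ≤ K * (g.len (blk q))⁻¹ * B6.c1 d δ₀ (δ₁ / (2 * δ₀)) * ‖μ‖ :=
          mul_le_mul_of_nonneg_right (mul_le_mul_of_nonneg_left (hrow (blk q)) hKl) (norm_nonneg _)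
      _ = K * B6.c1 d δ₀ (δ₁ / (2 * δ₀)) * (g.len (blk q))⁻¹ * ‖μ‖ := by ring

end SupOperator

end Literature.MathematicalPhysics.QuantumFieldTheory.Balaban1983to89.B9Ineq3133KernelConcrete

end
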